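import Summits.ABC.ABC.Theses.IsogenyGlueCongruence
import Summits.ABC.ABC.Theses.RibetTakahashiSplit
import Summits.ABC.ABC.Theorems.IsogenyGlueCongruenceMazurKenkuBoundProp51AndFourFacts
import Literature.NumberTheory.EllipticCurves.NeronIsogenyScalingHoldsProofs
import HarnessLib

/-!
# Route `IsogenyGlueCongruence`, crux `MazurKenkuBound` (stmt-ABC-15125), line `Sketch` —
# cycle 4: the crux from THREE printed facts (the Néron scaling is discharged)

WHAT. The crux `Summit.ABC.ABC.Theses.IsogenyGlueCongruence.MazurKenkuBound` (Pasten 2024 §3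
p. 13: `deg φ_{D'} ≤ 163 · deg φ_D` inside a `ℚ`-isogeny class, `D'` a minimal datum of a globally
minimal model) was closed in cycle 2 modulo four printed facts (`mazurKenkuBound_of_four_facts`:
Mazur 1978 Cor. 4.4, Kenku's composite levels, the Néron scaling integrality, Edixhoven 1991
Prop. 2). The third of these, `integral_neronScaling_of_isGloballyMinimal`, is now a THEOREM of the
tree (`integral_neronScaling_of_isGloballyMinimal_holds`, `NeronIsogenyScalingHoldsProofs`,
2026-08-16), so the crux follows from the remaining three:

* `mazurKenkuBound_of_three_facts` — from Cor. 4.4 (`Mazur1978.cor44_valuation_j_le_one`),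
  `kenku_minimalLevels_mem_kenkuDegrees` and `edixhoven_int_of_neronLattice_eq_smul_periodLattice`;
* `mazurKenkuBound_of_mazur_of_kenku_of_edixhoven` — the same with Mazur's Theorem 1
  (`mazur_isogeny_irreducible`) in place of Cor. 4.4 (the registered stub form `stub_mazurThm1`);
* `mazurKenkuBound_of_cor44_of_kenku_of_edixhovenItem` — the same with the route ITEM
  `EdixhovenIntegrality` (stmt-ABC-15990, definitionally the Edixhoven fact) as the third input, so
  that a proof of that item feeds this crux with no rewriting (route-choice cb3fc231);
* `mazurKenkuBound_of_radiusItem_of_edixhovenItem` — **the crux from TWO sibling crux items and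
  nothing else**: `MazurKenkuRadius` (stmt-ABC-15193, route `RibetTakahashiSplit`: two
  `ℚ`-isogenous elliptic curves over `ℚ` are joined by a `ℚ`-isogeny of degree `≤ 163`) and
  `EdixhovenIntegrality` (stmt-ABC-15990). With the Néron scaling discharged, the whole Mazur–Kenku
  side of this crux (Mazur's Theorem 1 + the barrier exclusions + the coverage certificate) is
  consumed only through the radius, so for the planners stmt-ABC-15125 is now an ASSEMBLY of
  stmt-ABC-15193 and stmt-ABC-15990 (its own residual content is empty).

Nothing here is unconditional: the item stays open; its trust base is displayed and is one fact
shorter than in cycle 2. [cite: PastenShimura2024, §3 p. 13]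
-/

-- `Summit.<Summit>.<Problem>` is the mandated summit-side namespace (CONVENTIONS §2); for the
-- single-conjunct summit `ABC` the two coincide, so the duplicate `ABC.ABC` is deliberate.
set_option linter.dupNamespace false

noncomputable section

open Literature.NumberTheory.EllipticCurves

namespace Summit.ABC.ABC.Theorems

/-- **The crux `MazurKenkuBound` (stmt-ABC-15125) from THREE printed facts** — Mazur 1978
Cor. 4.4 (Eisenstein quotient; Prop. 5.1 and the rest of the proof of Thm. 1 are theorems of the
tree), Kenku's composite levels (`kenku_minimalLevels_mem_kenkuDegrees`) and Edixhoven's Prop. 2 in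
lattice form (`edixhoven_int_of_neronLattice_eq_smul_periodLattice`); the fourth input of
`mazurKenkuBound_of_four_facts`, the Néron scaling integrality, is supplied by the tree's
`integral_neronScaling_of_isGloballyMinimal_holds`. [cite: PastenShimura2024, §3 p. 13]
[cite: Mazur1978, Thm. 1 and Cor. 4.4] [cite: Kenku1982, Thm. 1] [cite: EdixhovenManin1991, Prop. 2] -/
theorem mazurKenkuBound_of_three_facts (h44 : Mazur1978.cor44_valuation_j_le_one)
    (hK : kenku_minimalLevels_mem_kenkuDegrees)
    (hEd : Literature.NumberTheory.EllipticCurves.edixhoven_int_of_neronLattice_eq_smul_periodLattice) :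
    Summit.ABC.ABC.Theses.IsogenyGlueCongruence.MazurKenkuBound :=
  mazurKenkuBound_of_four_facts h44 hK integral_neronScaling_of_isGloballyMinimal_holds hEd

/-- **The crux from Mazur's Theorem 1, Kenku's composite levels and Edixhoven's Prop. 2** (the
registered stub forms of line `Sketch`: `stub_mazurThm1 = mazur_isogeny_irreducible`,
`stub_barrierExcluded ⇐ kenku_minimalLevels_mem_kenkuDegrees` by `barrierExcluded_of_kenku`,
`stub_edixhoven`): radius `≤ 163` by `stub_radius_of_mazur_of_barrier` over the landed coverage
certificate `stub_barrierCovers`; `hInt` by the optimal pivot with the Néron scaling discharged.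
[cite: PastenShimura2024, §3 p. 13] [cite: Mazur1978, Thm. 1] [cite: Kenku1982, Thm. 1]
[cite: EdixhovenManin1991, Prop. 2] -/
theorem mazurKenkuBound_of_mazur_of_kenku_of_edixhoven (hM : mazur_isogeny_irreducible)
    (hK : kenku_minimalLevels_mem_kenkuDegrees)
    (hEd : Literature.NumberTheory.EllipticCurves.edixhoven_int_of_neronLattice_eq_smul_periodLattice) :
    Summit.ABC.ABC.Theses.IsogenyGlueCongruence.MazurKenkuBound :=
  pastenShimura_minimalDegree_le_163_mul_of_radius
    (stub_radius_of_mazur_of_barrier _ stub_barrierCovers (barrierExcluded_of_kenku hK) hM)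
    (hInt_of_pivot integral_neronScaling_of_isGloballyMinimal_holds hEd)

/-- **Item form**: the crux `MazurKenkuBound` (stmt-ABC-15125) from Cor. 4.4, Kenku's composite
levels and the route ITEM `EdixhovenIntegrality` (stmt-ABC-15990), which is definitionally the
Literature fact `edixhoven_int_of_neronLattice_eq_smul_periodLattice` (route-choice cb3fc231), so a
proof of that item closes the third input of this crux with no rewriting.
[cite: PastenShimura2024, §3 p. 13] [cite: EdixhovenManin1991, Prop. 2] -/
theorem mazurKenkuBound_of_cor44_of_kenku_of_edixhovenItem (h44 : Mazur1978.cor44_valuation_j_le_one)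
    (hK : kenku_minimalLevels_mem_kenkuDegrees)
    (hEd : Summit.ABC.ABC.Theses.IsogenyGlueCongruence.EdixhovenIntegrality) :
    Summit.ABC.ABC.Theses.IsogenyGlueCongruence.MazurKenkuBound :=
  mazurKenkuBound_of_three_facts h44 hK hEd

/-- **The crux `MazurKenkuBound` (stmt-ABC-15125) is an assembly of two sibling crux items**:
`MazurKenkuRadius` (stmt-ABC-15193, route `RibetTakahashiSplit`: isogenous elliptic curves over
`ℚ` are joined by a `ℚ`-isogeny of degree `≤ 163` — Mazur 1978 Thm. 1 + Kenku 1982) and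
`EdixhovenIntegrality` (stmt-ABC-15990: Edixhoven 1991 Prop. 2 in lattice form). Proof: the radius
is verbatim the hypothesis `hRad` of the landed glue `pastenShimura_minimalDegree_le_163_mul_of_radius`,
and `hInt` is the optimal pivot `hInt_of_pivot` fed with the DISCHARGED Néron scaling
`integral_neronScaling_of_isGloballyMinimal_holds` and the Edixhoven item (definitionally the
Literature fact). [cite: PastenShimura2024, §3 p. 13] [cite: EdixhovenManin1991, Prop. 2] -/
theorem mazurKenkuBound_of_radiusItem_of_edixhovenItem
    (hRad : Summit.ABC.ABC.Theses.RibetTakahashiSplit.MazurKenkuRadius)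
    (hEd : Summit.ABC.ABC.Theses.IsogenyGlueCongruence.EdixhovenIntegrality) :
    Summit.ABC.ABC.Theses.IsogenyGlueCongruence.MazurKenkuBound :=
  pastenShimura_minimalDegree_le_163_mul_of_radius hRad
    (hInt_of_pivot integral_neronScaling_of_isGloballyMinimal_holds hEd)

end Summit.ABC.ABC.Theorems

end
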